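import Summits.RiemannHypothesis.RiemannHypothesis.Theses.SpectralTrace
import Summits.RiemannHypothesis.RiemannHypothesis.Theorems.WindowStep.Negative.Collapse
import HarnessLib

/-!
# `WindowStep` — negative lemma: load-bearing analysis of the binders

Refuter (crux disprover) record for the crux `stmt-RiemannHypothesis-14659`
(`Summit.RiemannHypothesis.RiemannHypothesis.Theses.SpectralTrace.WindowStep` =
`∀ n ≥ 2, Trace(log n) → Trace(log (n+1))`). Each binder of the crux is dropped in turn and the
mutated statement is located exactly (all kernel-checked, sorry-free, no arithmetic input beyond
the landed `Collapse.lean`):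

* `windowTrace_of_nonpos`: windows of half-width `A ≤ 0` admit only the zero test, so `Trace(A)`
  holds trivially there (empty family; `weilFunctional 0 = 0`). Hence the rungs `n = 0, 1`
  (`log 0 = log 1 = 0` in Mathlib) are free, and
* `windowStep_without_two_le_iff_riemannHypothesis` (**H1: the bound `2 ≤ n`**): the step over
  ALL `n : ℕ` is `RiemannHypothesis` itself — its instance `n = 1` is the seed
  `Trace(0) → Trace(log 2) = WindowTraceArch`; likewise from `1 ≤ n`
  (`windowStep_from_one_iff_riemannHypothesis`). So the binder `2 ≤ n` is worth exactly the seed: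
  `windowStep_from_one_iff_windowTraceArch_and_windowStep`.
* `windowStep_without_rung_iff_riemannHypothesis` (**H2: the rung hypothesis**): the bare
  conclusion `∀ n ≥ 2, Trace(log (n+1))` is the ladder, i.e. `RiemannHypothesis`.
* `windowJump_iff_windowStep` (**H3: the support restriction in the conclusion is idle**):
  replacing the conclusion `Trace(log (n+1))` by the full thesis `X` (all tests, no window) does
  not change the statement — "one rung at a time" and "one rung gives everything" are the same
  proposition. (Realness of `γ` and `IsWeilTest` are analysed in the sibling files
  `SpectralThesis/Negative/LoadBearing.lean`, `WindowTraceArch/Negative/WithoutIsWeilTest.lean`.)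

Upshot for provers: the only binder carrying content is the pair (seed inside the hypothesis,
RH inside the conclusion) — `Collapse.lean`: `WindowStep ↔ (WindowTraceArch → RH)`.
-/

set_option linter.dupNamespace false

noncomputable section

open Complex Set

namespace Summit.RiemannHypothesis.RiemannHypothesis.Theorems.WindowStep.Negative

open Literature.NumberTheory.LFunctions
open Summit.RiemannHypothesis.RiemannHypothesis.Theses.SpectralTrace
open Summit.RiemannHypothesis.RiemannHypothesis.Theorems

/-- File-local spelling of `Trace(A)` (as in `Collapse.lean`). A notation, not a definition. -/
local notation3 "WTrace " A:max => ∃ (ι : Type) (γ : ι → ℝ), ∀ g : ℝ → ℂ, IsWeilTest g →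
  tsupport g ⊆ Set.Icc (-A) A →
    HasSum (fun i => weilMellin g (1 / 2 + (γ i : ℂ) * I)) (weilFunctional g)

/-! ### Degenerate windows -/

/-- A Weil test supported in `[-A, A]` with `A ≤ 0` vanishes identically (its support is open
and sits inside an interval with empty interior). [folklore] -/
theorem eq_zero_of_tsupport_subset_Icc_nonpos {A : ℝ} (hA : A ≤ 0) {g : ℝ → ℂ}
    (hg : IsWeilTest g) (hgs : tsupport g ⊆ Icc (-A) A) : g = 0 := by
  have hsub : Function.support g ⊆ Icc (-A) A := (subset_tsupport g).trans hgs
  have hopen : IsOpen (Function.support g) := hg.1.continuous.isOpen_support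
  have hint : interior (Icc (-A) A) = ∅ := by
    rw [interior_Icc, Ioo_eq_empty_of_le (by linarith)]
  have h := interior_maximal hsub hopen
  rw [hint, subset_empty_iff, Function.support_eq_empty_iff] at h
  exact h

/-- The Weil functional of the zero test is `0`. [folklore] -/
theorem weilFunctional_zero_fun : weilFunctional 0 = 0 := by
  simp [weilFunctional, weilPolarTerm, weilPrimeTerm, weilArchTerm, weilArchIntegral, weilMellin]

/-- **Degenerate windows are free.** For `A ≤ 0` the window `[-A, A]` carries only the zero
test, so `Trace(A)` holds with the EMPTY family. [folklore] -/
theorem windowTrace_of_nonpos {A : ℝ} (hA : A ≤ 0) : WTrace A := by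
  refine ⟨Empty, fun i => i.elim, fun g hg hgs => ?_⟩
  have h0 : g = 0 := eq_zero_of_tsupport_subset_Icc_nonpos hA hg hgs
  subst h0
  have e : (fun i : Empty => weilMellin 0 (1 / 2 + (((fun i : Empty => (i.elim : ℝ)) i : ℝ) : ℂ) * I))
      = fun _ => 0 := funext fun i => i.elim
  rw [weilFunctional_zero_fun, e]
  exact hasSum_zero

/-- Rung `n = 1` is free (`log 1 = 0`). [folklore] -/
theorem windowTrace_log_one : WTrace (Real.log ((1 : ℕ) : ℝ)) := by
  simp only [Nat.cast_one, Real.log_one]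
  exact windowTrace_of_nonpos le_rfl

/-- Rung `n = 0` is free (`log 0 = 0` in Mathlib). [folklore] -/
theorem windowTrace_log_zero : WTrace (Real.log ((0 : ℕ) : ℝ)) := by
  simp only [Nat.cast_zero, Real.log_zero]
  exact windowTrace_of_nonpos le_rfl

/-! ### (H1) the binder `2 ≤ n` -/

/-- **(H1)** Dropping `2 ≤ n` turns the crux into RH: the instance `n = 1` is the seed
`Trace(0) → Trace(log 2)`, and seed + step is RH (`Collapse`). [folklore] -/
theorem windowStep_without_two_le_iff_riemannHypothesis :
    (∀ n : ℕ, (WTrace (Real.log (n : ℝ))) → WTrace (Real.log ((n : ℝ) + 1))) ↔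
      _root_.RiemannHypothesis := by
  constructor
  · intro h
    have hArch : WindowTraceArch := by
      have h1 := h 1 windowTrace_log_one
      norm_num at h1
      exact h1
    exact riemannHypothesis_of_windowTraceArch_of_windowStep hArch fun n _ hT => h n hT
  · intro hRH n _
    exact windowTrace_of_riemannHypothesis hRH _

/-- **(H1')** The same from `1 ≤ n`. [folklore] -/
theorem windowStep_from_one_iff_riemannHypothesis :
    (∀ n : ℕ, 1 ≤ n → (WTrace (Real.log (n : ℝ))) → WTrace (Real.log ((n : ℝ) + 1))) ↔
      _root_.RiemannHypothesis := by
  constructor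
  · intro h
    have hArch : WindowTraceArch := by
      have h1 := h 1 le_rfl windowTrace_log_one
      norm_num at h1
      exact h1
    exact riemannHypothesis_of_windowTraceArch_of_windowStep hArch
      fun n hn hT => h n (le_trans one_le_two hn) hT
  · intro hRH n _ _
    exact windowTrace_of_riemannHypothesis hRH _

/-- **What `2 ≤ n` is worth: exactly the seed.** The step from `1` is `WindowTraceArch ∧
WindowStep`. [folklore] -/
theorem windowStep_from_one_iff_windowTraceArch_and_windowStep :
    (∀ n : ℕ, 1 ≤ n → (WTrace (Real.log (n : ℝ))) → WTrace (Real.log ((n : ℝ) + 1))) ↔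
      (WindowTraceArch ∧ WindowStep) := by
  rw [windowStep_from_one_iff_riemannHypothesis,
    windowTraceArch_and_windowStep_iff_riemannHypothesis]

/-- Without the seed nothing distinguishes the crux from its mutant: `WindowStep` holds but the
step from `1` fails exactly when `¬ WindowTraceArch ∧ ¬ RH`. [folklore] -/
theorem windowStep_and_not_from_one_iff :
    (WindowStep ∧ ¬ ∀ n : ℕ, 1 ≤ n → (WTrace (Real.log (n : ℝ))) →
        WTrace (Real.log ((n : ℝ) + 1))) ↔
      (¬ WindowTraceArch ∧ ¬ _root_.RiemannHypothesis) := by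
  rw [windowStep_from_one_iff_riemannHypothesis,
    windowStep_iff_windowTraceArch_imp_riemannHypothesis]
  tauto

/-! ### (H2) the rung hypothesis -/

/-- **(H2)** Dropping the rung hypothesis leaves the ladder `∀ n ≥ 2, Trace(log (n+1))`, which
is RH. [folklore] -/
theorem windowStep_without_rung_iff_riemannHypothesis :
    (∀ n : ℕ, 2 ≤ n → WTrace (Real.log ((n : ℝ) + 1))) ↔ _root_.RiemannHypothesis := by
  constructor
  · intro h
    have h3 : WTrace (Real.log 3) := by
      have h2 := h 2 le_rfl
      norm_num at h2
      exact h2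
    have hArch : WindowTraceArch :=
      windowTrace_anti (Real.log_le_log two_pos (by norm_num)) h3
    exact riemannHypothesis_of_windowTraceArch_of_windowStep hArch fun n hn _ => h n hn
  · intro hRH n _
    exact windowTrace_of_riemannHypothesis hRH _

/-! ### (H3) the support restriction in the conclusion -/

/-- **(H3)** Replacing the conclusion `Trace(log (n+1))` by the window-free thesis `X` does not
change the proposition: the rung-by-rung structure is logically idle. [folklore] -/
theorem windowJump_iff_windowStep :
    (∀ n : ℕ, 2 ≤ n → (WTrace (Real.log (n : ℝ))) → SpectralThesis) ↔ WindowStep := by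
  rw [windowStep_iff_windowTraceArch_imp_spectralThesis]
  constructor
  · intro h hArch
    obtain ⟨ι, γ, hγ⟩ := hArch
    refine h 2 le_rfl ⟨ι, γ, fun g hg hgs => hγ g hg ?_⟩
    simpa only [Nat.cast_ofNat] using hgs
  · intro h n hn hT
    exact h (seed_of_rung hn hT)

end Summit.RiemannHypothesis.RiemannHypothesis.Theorems.WindowStep.Negative

end
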